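import Mathlib
import HarnessLib
import Summits.Ventures.LatticeQCDFlow.Exactness.SphereFlowL1Stability
import Summits.Ventures.LatticeQCDFlow.Exactness.SphereLOFlowEffectiveAction
import Summits.Ventures.LatticeQCDFlow.Exactness.SphereLuscherLocalTermBounds

/-!
# The exact leading-order trivializing flow of the lattice CP(N−1)/O(N) action is `ℓ¹`-stable with rate `3|κ|υ/(d−1)`, and its effective action is `ℓ¹`-Lipschitz in the initial configuration with constant `(6κ²υ²/(d−1))·c²·e^{3|κ|υc/(d−1)}` — both independent of the volume

HONEST FRAMING: exact (Metropolis-corrected) sampling algorithms for lattice gauge theory;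
figures of merit are autocorrelation/cost numbers at stated couplings and volumes; no
continuum-physics claim.

Venture `LatticeQCDFlow` (cell pub-lqcd), topic `Exactness`; FANOUT row 7 (`s0-cpn-null`: the
S0-D1 rung — 2D CP⁹, Lüscher's LO trivializing map inside HMC, Engel–Schaefer 2011).  NEW WORK of
the cell over the tree's `Exactness/SphereFlowL1Stability.lean` (this leg: Grönwall in `ℓ¹(Λ; E)`
for the time-dependent flow under an `ℓ¹`-modulus of the generator),
`Exactness/SphereLOFlowEffectiveAction.lean` (GEN-15: the effective action of the exact LO flow
`c·S(Φ_{0→c}y) − ℓ_{0→c}(y) = c·S₀ − ∫_0^c u·V₀(Φ_{0→u}y) du`),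
`Exactness/SphereLuscherLocalTermBounds.lean` (GEN-11: `‖J_k‖ ≤ υ`, `‖P_uJ‖ ≤ ‖J‖`) and
`Exactness/SphereLOFlowAction.lean` (E–S eq. (16): `T_n = (κ/(d−1))·P_{x_n}J_n`); nothing is cited
as a fact.  Printed counterpart, NAMED ONLY: G. P. Engel, S. Schaefer, Comput. Phys. Commun. 182
(2011) 2107, §3 eqs. (14)–(18); M. Lüscher, Commun. Math. Phys. 293 (2010) 899, §3 and §4.5 (the
generator of the trivializing flow is a local field; locality of flow-defined maps).

## Setting

`E` finite-dimensional real inner product space, `d = dim E ≥ 2`; `Λ` finite; `Ω̃ = {x | ‖x_n‖ = 1}`;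
E–S couplings `U` (no self-coupling `U_nn = 0`, adjoint pairs `U_mn = U_nm†`) of local weight
`Σ_m ‖U_km‖ ≤ υ` at every site; `S = esAction κ S₀ U`, `S̃⁽⁰⁾ = loFlowAction κ S₀ U`,
`J_n = localField U n`, `p_n = tangentKick (J_n x) (x_n)`; `Φ_{t₀→t₁}` the exact flow of the
constant generator `S̃⁽⁰⁾` (`sphereTDFlow`, horizon `T`); `K = 3|κ|υ/(d−1)`.

## Content

* §1 `norm_coupling_comm` (`‖U_mn‖ = ‖U_nm‖`), `sum_norm_coupling_col_le` (column sums `≤ υ`),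
  **`norm_tangentKick_sub_tangentKick_le`** (`‖P_a v − P_b w‖ ≤ ‖v − w‖ + 2‖v‖·‖a − b‖` for unit
  `a, b`), `norm_localField_sub_le`, **`sum_norm_tangentKick_localField_sub_le`**
  (`Σ_n ‖p_n(x) − p_n(y)‖ ≤ 3υ·Σ_j ‖x_j − y_j‖` on `Ω̃`), **`sum_norm_siteGrad_loFlowAction_sub_le`** —
  THE `ℓ¹`-MODULUS OF THE LO GENERATOR: `Σ_n ‖∂̃_nS̃⁽⁰⁾(x) − ∂̃_nS̃⁽⁰⁾(y)‖ ≤ K·Σ_j ‖x_j − y_j‖`,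
  `K = 3|κ|υ/(d−1)`, FOR EVERY FINITE LATTICE.
* §2 **`sum_norm_loFlow_sub_le`** — THE EXACT LO FLOW IS `ℓ¹`-STABLE:
  `Σ_n ‖Φ_{t₀→t₁}(x)_n − Φ_{t₀→t₁}(y)_n‖ ≤ e^{K|t₁−t₀|}·Σ_n ‖x_n − y_n‖` on `Ω̃`, all `t₀, t₁`;
  **`abs_loCarre_sub_le`** (`|V₀(x) − V₀(y)| ≤ (12κ²υ²/(d−1))·Σ_j ‖x_j − y_j‖`,
  `V₀ = (2κ²/(d−1))Σ_n‖p_n‖²`).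
* §3 **`abs_effAction_loFlow_sub_le`** — THE EFFECTIVE ACTION OF THE EXACT LO FLOW IS
  `ℓ¹`-LIPSCHITZ IN THE INITIAL CONFIGURATION: for `0 ≤ c ≤ |T| + 1` and `x, y ∈ Ω̃`,
  `|S_eff(x) − S_eff(y)| ≤ (6κ²υ²/(d−1))·c²·e^{Kc}·Σ_j ‖x_j − y_j‖`,
  `S_eff(y) = c·S(Φ_{0→c}y) − ℓ_{0→c}(y)`; **`abs_effAction_loFlow_update_sub_le`** — ITS BOUNDED
  DIFFERENCES: modifying ONE site of the initial configuration changes `S_eff` by at most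
  `(12κ²υ²/(d−1))·c²·e^{Kc}` — quadratic in the flow time, independent of the site, the
  configuration and the VOLUME (the input of McDiarmid / Efron–Stein in the sequel).

NOT CLAIMED: sharpness of the constants; the site-resolved light cone; anything about the one-step
map run by the rung; numbers of the rung.
-/

noncomputable section

namespace Summit.Ventures.LatticeQCDFlow.Exactness

open Function Set Metric MeasureTheory NormedSpace InnerProductSpace
open scoped RealInnerProductSpace Topology

variable {Λ : Type*} {E : Type*} [NormedAddCommGroup E] [InnerProductSpace ℝ E]
  [FiniteDimensional ℝ E] [Fintype Λ] [DecidableEq Λ] {U : Λ → Λ → (E →L[ℝ] E)} {T : ℝ}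

/-! ## §1 The `ℓ¹`-modulus of the leading-order generator -/

section Modulus

omit [Fintype Λ] [DecidableEq Λ] in
/-- Adjoint-pair couplings have `‖U_mn‖ = ‖U_nm‖`. -/
theorem norm_coupling_comm (hUadj : ∀ m n (v w : E), ⟪U m n v, w⟫ = ⟪v, U n m w⟫) (m n : Λ) :
    ‖U m n‖ = ‖U n m‖ := by
  haveI : CompleteSpace E := FiniteDimensional.complete ℝ E
  have h : U m n = ContinuousLinearMap.adjoint (U n m) :=
    (ContinuousLinearMap.eq_adjoint_iff _ _).2 fun v w => hUadj m n v w
  rw [h]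
  exact LinearIsometryEquiv.norm_map _ _

omit [DecidableEq Λ] in
/-- Column sums of the coupling weights are row sums: `Σ_k ‖U_km‖ ≤ υ`. -/
theorem sum_norm_coupling_col_le (hUadj : ∀ m n (v w : E), ⟪U m n v, w⟫ = ⟪v, U n m w⟫) {υ : ℝ}
    (hυ : ∀ k, ∑ m, ‖U k m‖ ≤ υ) (m : Λ) : ∑ k, ‖U k m‖ ≤ υ := by
  calc ∑ k, ‖U k m‖ = ∑ k, ‖U m k‖ := Finset.sum_congr rfl fun k _ => norm_coupling_comm hUadj k m
    _ ≤ υ := hυ m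

omit [FiniteDimensional ℝ E] [Fintype Λ] [DecidableEq Λ] in
/-- **The tangential projection is Lipschitz in both arguments**: for unit vectors `a, b`,
`‖P_a v − P_b w‖ ≤ ‖v − w‖ + 2‖v‖·‖a − b‖` (`P_a v = v − ⟪v, a⟫a`). -/
theorem norm_tangentKick_sub_tangentKick_le {a b : E} (ha : ‖a‖ = 1) (hb : ‖b‖ = 1) (v w : E) :
    ‖tangentKick v a - tangentKick w b‖ ≤ ‖v - w‖ + 2 * ‖v‖ * ‖a - b‖ := by
  have hdec : tangentKick v a - tangentKick w b =
      tangentKick (v - w) b + (⟪v, b⟫ • (b - a) + ⟪v, b - a⟫ • a) := by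
    simp only [tangentKick, inner_sub_left, inner_sub_right, sub_smul, smul_sub]
    abel
  rw [hdec]
  have h1 : ‖tangentKick (v - w) b‖ ≤ ‖v - w‖ := norm_tangentKick_le hb _
  have h2 : ‖⟪v, b⟫ • (b - a)‖ ≤ ‖v‖ * ‖a - b‖ := by
    rw [norm_smul, norm_sub_rev b a]
    refine mul_le_mul_of_nonneg_right ?_ (norm_nonneg _)
    calc ‖⟪v, b⟫‖ ≤ ‖v‖ * ‖b‖ := norm_inner_le_norm v b
      _ = ‖v‖ := by rw [hb, mul_one]
  have h3 : ‖⟪v, b - a⟫ • a‖ ≤ ‖v‖ * ‖a - b‖ := by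
    rw [norm_smul, ha, mul_one, norm_sub_rev a b]
    exact norm_inner_le_norm v (b - a)
  calc ‖tangentKick (v - w) b + (⟪v, b⟫ • (b - a) + ⟪v, b - a⟫ • a)‖
      ≤ ‖tangentKick (v - w) b‖ + (‖⟪v, b⟫ • (b - a)‖ + ‖⟪v, b - a⟫ • a‖) :=
        (norm_add_le _ _).trans (by gcongr; exact norm_add_le _ _)
    _ ≤ ‖v - w‖ + (‖v‖ * ‖a - b‖ + ‖v‖ * ‖a - b‖) := by gcongr
    _ = ‖v - w‖ + 2 * ‖v‖ * ‖a - b‖ := by ring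

omit [FiniteDimensional ℝ E] [DecidableEq Λ] in
/-- `‖J_n(x) − J_n(y)‖ ≤ Σ_m ‖U_nm‖·‖x_m − y_m‖`. -/
theorem norm_localField_sub_le (U : Λ → Λ → (E →L[ℝ] E)) (n : Λ) (x y : Λ → E) :
    ‖localField U n x - localField U n y‖ ≤ ∑ m, ‖U n m‖ * ‖x m - y m‖ := by
  have h : localField U n x - localField U n y = ∑ m, U n m (x m - y m) := by
    simp only [localField, map_sub, Finset.sum_sub_distrib]
  rw [h]
  exact (norm_sum_le _ _).trans (Finset.sum_le_sum fun m _ => (U n m).le_opNorm _)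

omit [DecidableEq Λ] in
/-- **`Σ_n ‖p_n(x) − p_n(y)‖ ≤ 3υ·Σ_j ‖x_j − y_j‖` on `Ω̃`** (`p_n = P_{x_n}J_n`; adjoint-pair
couplings of local weight `≤ υ`). -/
theorem sum_norm_tangentKick_localField_sub_le
    (hUadj : ∀ m n (v w : E), ⟪U m n v, w⟫ = ⟪v, U n m w⟫) {υ : ℝ} (hυ : ∀ k, ∑ m, ‖U k m‖ ≤ υ)
    {x y : Λ → E} (hx : ∀ n, ‖x n‖ = 1) (hy : ∀ n, ‖y n‖ = 1) :
    ∑ n, ‖tangentKick (localField U n x) (x n) - tangentKick (localField U n y) (y n)‖ ≤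
      3 * υ * ∑ j, ‖x j - y j‖ := by
  have hsite : ∀ n, ‖tangentKick (localField U n x) (x n) - tangentKick (localField U n y) (y n)‖ ≤
      ∑ m, ‖U n m‖ * ‖x m - y m‖ + 2 * υ * ‖x n - y n‖ := by
    intro n
    have h := norm_tangentKick_sub_tangentKick_le (hx n) (hy n) (localField U n x) (localField U n y)
    have hJ : ‖localField U n x‖ ≤ υ := norm_localField_le hυ hx n
    calc _ ≤ ‖localField U n x - localField U n y‖ + 2 * ‖localField U n x‖ * ‖x n - y n‖ := h
      _ ≤ ∑ m, ‖U n m‖ * ‖x m - y m‖ + 2 * υ * ‖x n - y n‖ := by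
          gcongr
          exact norm_localField_sub_le U n x y
  calc _ ≤ ∑ n, (∑ m, ‖U n m‖ * ‖x m - y m‖ + 2 * υ * ‖x n - y n‖) := Finset.sum_le_sum fun n _ => hsite n
    _ = ∑ m, (∑ n, ‖U n m‖) * ‖x m - y m‖ + 2 * υ * ∑ n, ‖x n - y n‖ := by
        rw [Finset.sum_add_distrib, Finset.sum_comm, ← Finset.mul_sum]
        congr 1
        exact Finset.sum_congr rfl fun m _ => by rw [Finset.sum_mul]
    _ ≤ ∑ m, υ * ‖x m - y m‖ + 2 * υ * ∑ n, ‖x n - y n‖ := by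
        gcongr with m _
        exact sum_norm_coupling_col_le hUadj hυ m
    _ = 3 * υ * ∑ j, ‖x j - y j‖ := by rw [← Finset.mul_sum]; ring

/-- **THE `ℓ¹`-MODULUS OF THE LEADING-ORDER GENERATOR**: for the E–S action (`d ≥ 2`, no
self-coupling, adjoint pairs, local weight `≤ υ`) and `x, y ∈ Ω̃`,
`Σ_n ‖∂̃_nS̃⁽⁰⁾(x) − ∂̃_nS̃⁽⁰⁾(y)‖ ≤ (3|κ|υ/(d−1))·Σ_j ‖x_j − y_j‖` — every finite lattice. -/
theorem sum_norm_siteGrad_loFlowAction_sub_le (hU0 : ∀ n, U n n = 0)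
    (hUadj : ∀ m n (v w : E), ⟪U m n v, w⟫ = ⟪v, U n m w⟫) (hd : 2 ≤ Module.finrank ℝ E)
    (κ S₀ : ℝ) {υ : ℝ} (hυ : ∀ k, ∑ m, ‖U k m‖ ≤ υ)
    {x y : Λ → E} (hx : ∀ n, ‖x n‖ = 1) (hy : ∀ n, ‖y n‖ = 1) :
    ∑ n, ‖siteGrad n (loFlowAction κ S₀ U) x - siteGrad n (loFlowAction κ S₀ U) y‖ ≤
      3 * |κ| * υ / ((Module.finrank ℝ E : ℝ) - 1) * ∑ j, ‖x j - y j‖ := by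
  have hd1 : 0 < (Module.finrank ℝ E : ℝ) - 1 := by
    have : (2 : ℝ) ≤ Module.finrank ℝ E := by exact_mod_cast hd
    linarith
  have hsite : ∀ n, ‖siteGrad n (loFlowAction κ S₀ U) x - siteGrad n (loFlowAction κ S₀ U) y‖ =
      |κ| / ((Module.finrank ℝ E : ℝ) - 1) *
        ‖tangentKick (localField U n x) (x n) - tangentKick (localField U n y) (y n)‖ := by
    intro n
    have ex : siteGrad n (loFlowAction κ S₀ U) x = -loGenerator κ S₀ U n x := by
      rw [loGenerator, neg_neg]
    have ey : siteGrad n (loFlowAction κ S₀ U) y = -loGenerator κ S₀ U n y := by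
      rw [loGenerator, neg_neg]
    rw [ex, ey, loGenerator_eq hU0 hUadj hd κ S₀ (hx n), loGenerator_eq hU0 hUadj hd κ S₀ (hy n),
      neg_sub_neg, ← smul_sub, norm_smul, norm_sub_rev, Real.norm_eq_abs, abs_div, abs_of_pos hd1]
  simp_rw [hsite]
  rw [← Finset.mul_sum]
  have h := sum_norm_tangentKick_localField_sub_le hUadj hυ hx hy
  calc |κ| / ((Module.finrank ℝ E : ℝ) - 1) *
        ∑ n, ‖tangentKick (localField U n x) (x n) - tangentKick (localField U n y) (y n)‖
      ≤ |κ| / ((Module.finrank ℝ E : ℝ) - 1) * (3 * υ * ∑ j, ‖x j - y j‖) :=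
        mul_le_mul_of_nonneg_left h (div_nonneg (abs_nonneg _) hd1.le)
    _ = 3 * |κ| * υ / ((Module.finrank ℝ E : ℝ) - 1) * ∑ j, ‖x j - y j‖ := by ring

end Modulus

/-! ## §2 `ℓ¹`-stability of the exact leading-order flow -/

section Flow

/-- **THE EXACT LO FLOW IS `ℓ¹`-STABLE, UNIFORMLY IN THE VOLUME**: for `x, y ∈ Ω̃` and all `t₀, t₁`,
`Σ_n ‖Φ_{t₀→t₁}(x)_n − Φ_{t₀→t₁}(y)_n‖ ≤ exp((3|κ|υ/(d−1))·|t₁ − t₀|)·Σ_n ‖x_n − y_n‖`. -/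
theorem sum_norm_loFlow_sub_le (hU0 : ∀ n, U n n = 0)
    (hUadj : ∀ m n (v w : E), ⟪U m n v, w⟫ = ⟪v, U n m w⟫) (hd : 2 ≤ Module.finrank ℝ E)
    (κ S₀ : ℝ) {υ : ℝ} (hυ : ∀ k, ∑ m, ‖U k m‖ ≤ υ)
    {x y : Λ → E} (hx : ∀ n, ‖x n‖ = 1) (hy : ∀ n, ‖y n‖ = 1) (t₀ t₁ : ℝ) :
    ∑ n, ‖sphereTDFlow (G := fun _ : ℝ => loFlowAction κ S₀ U)
          (contDiff_const_family (contDiff_loFlowAction U κ S₀)) T t₀ t₁ x n -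
        sphereTDFlow (G := fun _ : ℝ => loFlowAction κ S₀ U)
          (contDiff_const_family (contDiff_loFlowAction U κ S₀)) T t₀ t₁ y n‖ ≤
      Real.exp (3 * |κ| * υ / ((Module.finrank ℝ E : ℝ) - 1) * |t₁ - t₀|) * ∑ j, ‖x j - y j‖ :=
  sum_norm_sphereTDFlow_sub_le (G := fun _ : ℝ => loFlowAction κ S₀ U)
    (contDiff_const_family (contDiff_loFlowAction U κ S₀))
    (fun _ _ _ _ hx' hy' => sum_norm_siteGrad_loFlowAction_sub_le hU0 hUadj hd κ S₀ hυ hx' hy')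
    hx hy

omit [DecidableEq Λ] in
/-- **`V₀` is `ℓ¹`-Lipschitz**: `|V₀(x) − V₀(y)| ≤ (12κ²υ²/(d−1))·Σ_j ‖x_j − y_j‖` on `Ω̃`,
`V₀ = (2κ²/(d−1))·Σ_n ‖p_n‖²`. -/
theorem abs_loCarre_sub_le (hUadj : ∀ m n (v w : E), ⟪U m n v, w⟫ = ⟪v, U n m w⟫)
    (hd : 2 ≤ Module.finrank ℝ E) (κ : ℝ) {υ : ℝ} (hυ : ∀ k, ∑ m, ‖U k m‖ ≤ υ)
    {x y : Λ → E} (hx : ∀ n, ‖x n‖ = 1) (hy : ∀ n, ‖y n‖ = 1) :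
    |2 * κ ^ 2 / ((Module.finrank ℝ E : ℝ) - 1) * ∑ n, ‖tangentKick (localField U n x) (x n)‖ ^ 2 -
        2 * κ ^ 2 / ((Module.finrank ℝ E : ℝ) - 1) * ∑ n, ‖tangentKick (localField U n y) (y n)‖ ^ 2| ≤
      12 * κ ^ 2 * υ ^ 2 / ((Module.finrank ℝ E : ℝ) - 1) * ∑ j, ‖x j - y j‖ := by
  have hd1 : 0 < (Module.finrank ℝ E : ℝ) - 1 := by
    have : (2 : ℝ) ≤ Module.finrank ℝ E := by exact_mod_cast hd
    linarith
  have hC : 0 ≤ 2 * κ ^ 2 / ((Module.finrank ℝ E : ℝ) - 1) := div_nonneg (by positivity) hd1.le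
  set p : Λ → E := fun n => tangentKick (localField U n x) (x n) with hp
  set q : Λ → E := fun n => tangentKick (localField U n y) (y n) with hq
  have hpb : ∀ n, ‖p n‖ ≤ υ := fun n =>
    (norm_tangentKick_le (hx n) _).trans (norm_localField_le hυ hx n)
  have hqb : ∀ n, ‖q n‖ ≤ υ := fun n =>
    (norm_tangentKick_le (hy n) _).trans (norm_localField_le hυ hy n)
  -- `|Σ‖p‖² − Σ‖q‖²| ≤ 2υ Σ ‖p − q‖`
  have hsq : |∑ n, ‖p n‖ ^ 2 - ∑ n, ‖q n‖ ^ 2| ≤ 2 * υ * ∑ n, ‖p n - q n‖ := by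
    rw [← Finset.sum_sub_distrib, Finset.mul_sum]
    refine (Finset.abs_sum_le_sum_abs _ _).trans (Finset.sum_le_sum fun n _ => ?_)
    have e : ‖p n‖ ^ 2 - ‖q n‖ ^ 2 = (‖p n‖ + ‖q n‖) * (‖p n‖ - ‖q n‖) := by ring
    rw [e, abs_mul, abs_of_nonneg (add_nonneg (norm_nonneg _) (norm_nonneg _))]
    calc (‖p n‖ + ‖q n‖) * |‖p n‖ - ‖q n‖| ≤ (υ + υ) * ‖p n - q n‖ :=
          mul_le_mul (add_le_add (hpb n) (hqb n)) (abs_norm_sub_norm_le _ _) (abs_nonneg _)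
            (by linarith [norm_nonneg (p n), hpb n])
      _ = 2 * υ * ‖p n - q n‖ := by ring
  have hpq : ∑ n, ‖p n - q n‖ ≤ 3 * υ * ∑ j, ‖x j - y j‖ :=
    sum_norm_tangentKick_localField_sub_le hUadj hυ hx hy
  rw [← mul_sub, abs_mul, abs_of_nonneg hC]
  -- the empty lattice is trivial; otherwise `υ ≥ 0`
  rcases isEmpty_or_nonempty Λ with hΛ | hΛ
  · simp
  have hυ0 : 0 ≤ υ := le_trans (norm_nonneg _) (hpb (Classical.arbitrary Λ))
  calc 2 * κ ^ 2 / ((Module.finrank ℝ E : ℝ) - 1) * |∑ n, ‖p n‖ ^ 2 - ∑ n, ‖q n‖ ^ 2|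
      ≤ 2 * κ ^ 2 / ((Module.finrank ℝ E : ℝ) - 1) * (2 * υ * (3 * υ * ∑ j, ‖x j - y j‖)) := by
        refine mul_le_mul_of_nonneg_left (hsq.trans ?_) hC
        exact mul_le_mul_of_nonneg_left hpq (by positivity)
    _ = 12 * κ ^ 2 * υ ^ 2 / ((Module.finrank ℝ E : ℝ) - 1) * ∑ j, ‖x j - y j‖ := by ring

end Flow

/-! ## §3 The effective action of the exact LO flow is `ℓ¹`-Lipschitz in the initial configuration -/

section EffAction

/-- **THE EFFECTIVE ACTION OF THE EXACT LO FLOW IS `ℓ¹`-LIPSCHITZ, UNIFORMLY IN THE VOLUME.**  For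
the E–S action (`d ≥ 2`, no self-coupling, adjoint pairs, local weight `≤ υ`), `0 ≤ c ≤ |T| + 1`
and `x, y ∈ Ω̃`:
`|(c·S(Φ_{0→c}x) − ℓ_{0→c}(x)) − (c·S(Φ_{0→c}y) − ℓ_{0→c}(y))| ≤ (6κ²υ²/(d−1))·c²·e^{Kc}·Σ_j ‖x_j − y_j‖`,
`K = 3|κ|υ/(d−1)` (the integrated residual `∫_0^c u·(V₀(Φ_{0→u}x) − V₀(Φ_{0→u}y)) du`, the
`ℓ¹`-Lipschitz bound of `V₀` and the `ℓ¹`-stability of the flow). -/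
theorem abs_effAction_loFlow_sub_le (hU0 : ∀ n, U n n = 0)
    (hUadj : ∀ m n (v w : E), ⟪U m n v, w⟫ = ⟪v, U n m w⟫) (hd : 2 ≤ Module.finrank ℝ E)
    (κ S₀ : ℝ) {υ : ℝ} (hυ : ∀ k, ∑ m, ‖U k m‖ ≤ υ)
    {x y : Λ → E} (hx : ∀ n, ‖x n‖ = 1) (hy : ∀ n, ‖y n‖ = 1) {c : ℝ} (hc0 : 0 ≤ c)
    (hc : c ≤ |T| + 1) :
    |(c * esAction κ S₀ U (sphereTDFlow (G := fun _ : ℝ => loFlowAction κ S₀ U)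
          (contDiff_const_family (contDiff_loFlowAction U κ S₀)) T 0 c x) -
        sphereTDFlowLogJac (G := fun _ : ℝ => loFlowAction κ S₀ U)
          (contDiff_const_family (contDiff_loFlowAction U κ S₀)) T 0 c x) -
      (c * esAction κ S₀ U (sphereTDFlow (G := fun _ : ℝ => loFlowAction κ S₀ U)
          (contDiff_const_family (contDiff_loFlowAction U κ S₀)) T 0 c y) -
        sphereTDFlowLogJac (G := fun _ : ℝ => loFlowAction κ S₀ U)
          (contDiff_const_family (contDiff_loFlowAction U κ S₀)) T 0 c y)| ≤
      6 * κ ^ 2 * υ ^ 2 / ((Module.finrank ℝ E : ℝ) - 1) * c ^ 2 *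
        Real.exp (3 * |κ| * υ / ((Module.finrank ℝ E : ℝ) - 1) * c) * ∑ j, ‖x j - y j‖ := by
  have hc' : |c| ≤ |T| + 1 := by rwa [abs_of_nonneg hc0]
  -- the empty lattice is trivial; otherwise `υ ≥ 0`
  rcases isEmpty_or_nonempty Λ with hΛ | hΛ
  · have hxy : x = y := funext fun n => isEmptyElim n
    subst hxy
    simp
  have hυ0 : 0 ≤ υ :=
    le_trans (Finset.sum_nonneg fun m _ => norm_nonneg _) (hυ (Classical.arbitrary Λ))
  rw [effAction_loFlow_eq hU0 hUadj hd κ S₀ hx hc', effAction_loFlow_eq hU0 hUadj hd κ S₀ hy hc']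
  -- abbreviations
  set Φ : ℝ → (Λ → E) → (Λ → E) := fun u z => sphereTDFlow (G := fun _ : ℝ => loFlowAction κ S₀ U)
    (contDiff_const_family (contDiff_loFlowAction U κ S₀)) T 0 u z with hΦ
  set V : (Λ → E) → ℝ := fun z => 2 * κ ^ 2 / ((Module.finrank ℝ E : ℝ) - 1) *
    ∑ n, ‖tangentKick (localField U n z) (z n)‖ ^ 2 with hV
  set K : ℝ := 3 * |κ| * υ / ((Module.finrank ℝ E : ℝ) - 1) with hK
  set L : ℝ := ∑ j, ‖x j - y j‖ with hL
  set B : ℝ := 12 * κ ^ 2 * υ ^ 2 / ((Module.finrank ℝ E : ℝ) - 1) * Real.exp (K * c) * L with hB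
  have hd1 : 0 < (Module.finrank ℝ E : ℝ) - 1 := by
    have : (2 : ℝ) ≤ Module.finrank ℝ E := by exact_mod_cast hd
    linarith
  have hL0 : 0 ≤ L := Finset.sum_nonneg fun j _ => norm_nonneg _
  have h12 : 0 ≤ 12 * κ ^ 2 * υ ^ 2 / ((Module.finrank ℝ E : ℝ) - 1) :=
    div_nonneg (by positivity) hd1.le
  have hK0 : 0 ≤ K := div_nonneg (by positivity) hd1.le
  -- continuity of the integrands
  have hcont : ∀ z : Λ → E, Continuous fun u : ℝ => u * V (Φ u z) := by
    intro z
    have hΦc : Continuous fun u : ℝ => Φ u z :=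
      continuous_sphereTDFlow_time (contDiff_const_family (contDiff_loFlowAction U κ S₀)) 0 z
    have h2 := (continuous_sum_norm_tangentKick_sq U).comp hΦc
    exact continuous_id.mul (continuous_const.mul h2)
  -- pointwise bound on `[0, c]`
  have hpt : ∀ u ∈ Icc 0 c, |u * V (Φ u x) - u * V (Φ u y)| ≤ u * B := by
    intro u hu
    have hxu : ∀ n, ‖Φ u x n‖ = 1 := fun n => norm_sphereTDFlow_eq_one _ 0 hx u n
    have hyu : ∀ n, ‖Φ u y n‖ = 1 := fun n => norm_sphereTDFlow_eq_one _ 0 hy u n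
    have hVd : |V (Φ u x) - V (Φ u y)| ≤
        12 * κ ^ 2 * υ ^ 2 / ((Module.finrank ℝ E : ℝ) - 1) * ∑ j, ‖Φ u x j - Φ u y j‖ :=
      abs_loCarre_sub_le hUadj hd κ hυ hxu hyu
    have hflow : ∑ j, ‖Φ u x j - Φ u y j‖ ≤ Real.exp (K * |u - 0|) * L :=
      sum_norm_loFlow_sub_le hU0 hUadj hd κ S₀ hυ hx hy 0 u
    have hexp : Real.exp (K * |u - 0|) ≤ Real.exp (K * c) := by
      rw [sub_zero, abs_of_nonneg hu.1]
      exact Real.exp_le_exp.2 (mul_le_mul_of_nonneg_left hu.2 hK0)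
    rw [← mul_sub, abs_mul, abs_of_nonneg hu.1]
    refine mul_le_mul_of_nonneg_left (hVd.trans ?_) hu.1
    rw [hB]
    calc 12 * κ ^ 2 * υ ^ 2 / ((Module.finrank ℝ E : ℝ) - 1) * ∑ j, ‖Φ u x j - Φ u y j‖
        ≤ 12 * κ ^ 2 * υ ^ 2 / ((Module.finrank ℝ E : ℝ) - 1) * (Real.exp (K * c) * L) :=
          mul_le_mul_of_nonneg_left (hflow.trans (mul_le_mul_of_nonneg_right hexp hL0)) h12
      _ = _ := by ring
  -- integrate
  have hint : (c * S₀ - ∫ u in (0 : ℝ)..c, u * V (Φ u x)) - (c * S₀ - ∫ u in (0 : ℝ)..c, u * V (Φ u y)) =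
      -∫ u in (0 : ℝ)..c, (u * V (Φ u x) - u * V (Φ u y)) := by
    rw [intervalIntegral.integral_sub ((hcont x).intervalIntegrable 0 c)
      ((hcont y).intervalIntegrable 0 c)]
    ring
  rw [hint, abs_neg]
  have hdiffc : Continuous fun u : ℝ => u * V (Φ u x) - u * V (Φ u y) := (hcont x).sub (hcont y)
  calc |∫ u in (0 : ℝ)..c, (u * V (Φ u x) - u * V (Φ u y))|
      ≤ ∫ u in (0 : ℝ)..c, |u * V (Φ u x) - u * V (Φ u y)| :=
        intervalIntegral.abs_integral_le_integral_abs hc0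
    _ ≤ ∫ u in (0 : ℝ)..c, u * B :=
        intervalIntegral.integral_mono_on hc0 (hdiffc.abs.intervalIntegrable 0 c)
          ((continuous_id.mul continuous_const).intervalIntegrable 0 c) hpt
    _ = c ^ 2 / 2 * B := by rw [intervalIntegral.integral_mul_const, integral_id]; ring
    _ = _ := by rw [hB]; ring

/-- **BOUNDED DIFFERENCES OF THE EFFECTIVE ACTION**: for `x ∈ Ω̃`, a site `k`, a unit vector `v`
and `0 ≤ c ≤ |T| + 1`, replacing `x_k` by `v` changes `c·S(Φ_{0→c}·) − ℓ_{0→c}(·)` by at most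
`(12κ²υ²/(d−1))·c²·exp((3|κ|υ/(d−1))·c)` — independent of the site, the configuration and the
volume. -/
theorem abs_effAction_loFlow_update_sub_le (hU0 : ∀ n, U n n = 0)
    (hUadj : ∀ m n (v w : E), ⟪U m n v, w⟫ = ⟪v, U n m w⟫) (hd : 2 ≤ Module.finrank ℝ E)
    (κ S₀ : ℝ) {υ : ℝ} (hυ : ∀ k, ∑ m, ‖U k m‖ ≤ υ)
    {x : Λ → E} (hx : ∀ n, ‖x n‖ = 1) (k : Λ) {v : E} (hv : ‖v‖ = 1) {c : ℝ} (hc0 : 0 ≤ c)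
    (hc : c ≤ |T| + 1) :
    |(c * esAction κ S₀ U (sphereTDFlow (G := fun _ : ℝ => loFlowAction κ S₀ U)
          (contDiff_const_family (contDiff_loFlowAction U κ S₀)) T 0 c x) -
        sphereTDFlowLogJac (G := fun _ : ℝ => loFlowAction κ S₀ U)
          (contDiff_const_family (contDiff_loFlowAction U κ S₀)) T 0 c x) -
      (c * esAction κ S₀ U (sphereTDFlow (G := fun _ : ℝ => loFlowAction κ S₀ U)
          (contDiff_const_family (contDiff_loFlowAction U κ S₀)) T 0 c (update x k v)) -
        sphereTDFlowLogJac (G := fun _ : ℝ => loFlowAction κ S₀ U)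
          (contDiff_const_family (contDiff_loFlowAction U κ S₀)) T 0 c (update x k v))| ≤
      12 * κ ^ 2 * υ ^ 2 / ((Module.finrank ℝ E : ℝ) - 1) * c ^ 2 *
        Real.exp (3 * |κ| * υ / ((Module.finrank ℝ E : ℝ) - 1) * c) := by
  have hy : ∀ n, ‖update x k v n‖ = 1 := by
    intro n
    by_cases hn : n = k
    · subst hn; rw [update_self]; exact hv
    · rw [update_of_ne hn]; exact hx n
  have h := abs_effAction_loFlow_sub_le hU0 hUadj hd κ S₀ hυ hx hy hc0 hc (T := T)
  have hsum : ∑ j, ‖x j - update x k v j‖ = ‖x k - v‖ := by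
    rw [Finset.sum_eq_single k]
    · rw [update_self]
    · intro j _ hj; rw [update_of_ne hj, sub_self, norm_zero]
    · intro hk; exact absurd (Finset.mem_univ k) hk
  have h2 : ‖x k - v‖ ≤ 2 := by
    calc ‖x k - v‖ ≤ ‖x k‖ + ‖v‖ := norm_sub_le _ _
      _ = 2 := by rw [hx k, hv]; norm_num
  rw [hsum] at h
  have hd1 : 0 < (Module.finrank ℝ E : ℝ) - 1 := by
    have : (2 : ℝ) ≤ Module.finrank ℝ E := by exact_mod_cast hd
    linarith
  have hA : 0 ≤ 6 * κ ^ 2 * υ ^ 2 / ((Module.finrank ℝ E : ℝ) - 1) * c ^ 2 *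
      Real.exp (3 * |κ| * υ / ((Module.finrank ℝ E : ℝ) - 1) * c) :=
    mul_nonneg (mul_nonneg (div_nonneg (by positivity) hd1.le) (sq_nonneg c)) (Real.exp_pos _).le
  calc _ ≤ 6 * κ ^ 2 * υ ^ 2 / ((Module.finrank ℝ E : ℝ) - 1) * c ^ 2 *
        Real.exp (3 * |κ| * υ / ((Module.finrank ℝ E : ℝ) - 1) * c) * ‖x k - v‖ := h
    _ ≤ 6 * κ ^ 2 * υ ^ 2 / ((Module.finrank ℝ E : ℝ) - 1) * c ^ 2 *
        Real.exp (3 * |κ| * υ / ((Module.finrank ℝ E : ℝ) - 1) * c) * 2 :=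
        mul_le_mul_of_nonneg_left h2 hA
    _ = _ := by ring

end EffAction

end Summit.Ventures.LatticeQCDFlow.Exactness

end
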